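import Summits.ValiantsHypothesis.ValiantsHypothesis.Theorems.BarrierLeverAnchoredDoorHitsLowerPairsThinStepAligned

/-!
# Support item `AnchoredDoorHitsLowerPairs` (stmt-ValiantsHypothesis-22510), line `anchored-peeling`:
# THIN VERTEX STEP, part 4 — THE THIN VERTEX STEP (stub `stub_vertexStep` at every thin vertex, every profile `s ≥ 1`)

Helper file towards the registered open stub `stub_vertexStep` of the skeleton
`Cruxes/AnchoredDoorHitsLowerPairs/Lines/anchored_peeling.lean` (v5; planner valiant-natproofs-p1 g19, D-0145; lane val-np-p2).
Cell valiant-natproofs, rung V4, 𝒟-side door (c); prover seat val-np-p2 gen 11. Definition-free. Closes NO item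
(`--supports stmt-ValiantsHypothesis-22510`).

**THEOREM (`symbolicDet_ne_zero_of_thin`, the thin vertex step).** Let `(u, w)` be an injective layout whose column family
`C = Set.range w` is a simplicial complex (lower set), and let `a` be an `x`-vertex whose STAR in the rows is THIN:
`#{i : a ∈ u i} ≤ #{c : {c} ∈ C}` (at most as many rows through `a` as `C` has vertices). If every enumeration of the DELETION rows
`{S ∈ Set.range u : a ∉ S}` has nonzero symbolic minor against every injective lower sub-family of `C` of the right size — verbatim
the hypothesis of the registered `Stmt.stub_vertexStep` (val-np-p2 g10, `…VertexStep.lean`) — then `symbolicDet s h r u w ≠ 0`.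
So THE VERTEX STEP HOLDS AT EVERY THIN VERTEX, for every profile `s ≥ 1` (`stub_vertexStep_thin` is the profile-1 form, in the
exact shape of the stub plus the one inequality). No equality of star counts is required (contrast `stub_starStep`), and the rows
need not form a lower set.

PROOF. (1) `exists_upper_sdr`: from `m ≤ f₀(C)` distinct vertices `c₁, …, c_m` of `C` one builds an UPPER sub-family
`𝒯 = {T₁, …, T_m} ⊆ C` with `c_k ∈ T_k` (take `T₁` maximal through `c₁`, recurse in `C ∖ T₁`, which keeps the other vertices);
(2) a column permutation puts `T_k` in the position of the `k`-th row through `a` (`Equiv.extendSubtype`), so the layout carries a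
DESIGN in the sense of part 3 (`symbolicDet_ne_zero_of_thinDesign`), whose deletion block has the LOWER column family `C ∖ 𝒯` and is
nonsingular by the hypothesis; (3) column permutations only change the sign (`symbolicDet_ne_zero_of_perm`).

WHAT THIS IS NOT: the stub `stub_vertexStep` itself (thick vertices, `#St_a > f₀(C)`, remain open — that is where U1 lives); nothing on
items 22510 / 19717 themselves, on crux stmt-ValiantsHypothesis-14610, or on `VP` versus `VNP`.
-/

set_option linter.dupNamespace false

namespace Summit.ValiantsHypothesis.ValiantsHypothesis.Theorems.BarrierLever.AnchoredPeeling

open Finset MvPolynomial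
open Summit.ValiantsHypothesis.ValiantsHypothesis.Theorems.BarrierLever.BrickCalculus (pexpo)

noncomputable section

namespace ThinStep

variable {h : ℕ}

/-! ## 1. Upper systems of distinct representatives -/

/-- **Upper SDR.** In a finite family `C` of finsets, let `V` be a set of «vertices» (`{c} ∈ C` for `c ∈ V`) and `m ≤ |V|`. Then there
is an UPPER sub-family `𝒯 ⊆ C` (closed under supersets inside `C`) of size `m` with an injective choice of representatives
`rep T ∈ T ∩ V`. -/
theorem exists_upper_sdr (c₀ : Fin h) (m : ℕ) : ∀ (C : Finset (Finset (Fin h))) (V : Finset (Fin h)),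
    (∀ c ∈ V, ({c} : Finset (Fin h)) ∈ C) → m ≤ V.card →
    ∃ 𝒯 : Finset (Finset (Fin h)), 𝒯 ⊆ C ∧ 𝒯.card = m ∧ (∀ T ∈ 𝒯, ∀ T' ∈ C, T ⊆ T' → T' ∈ 𝒯) ∧
      ∃ rep : Finset (Fin h) → Fin h, (∀ T ∈ 𝒯, rep T ∈ T ∧ rep T ∈ V) ∧ Set.InjOn rep ↑𝒯 := by
  classical
  induction m with
  | zero =>
    intro C V _ _
    exact ⟨∅, Finset.empty_subset _, Finset.card_empty, fun T hT => absurd hT (Finset.notMem_empty T),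
      fun _ => c₀, fun T hT => absurd hT (Finset.notMem_empty T),
      fun T hT => absurd hT (Finset.notMem_empty T)⟩
  | succ m ih =>
    intro C V hV hm
    obtain ⟨c₁, hc₁⟩ : V.Nonempty := Finset.card_pos.mp (by omega)
    obtain ⟨T₁, hcT₁, hmax⟩ := Finset.exists_le_maximal C (hV c₁ hc₁)
    have hT₁C : T₁ ∈ C := hmax.prop
    have hc₁T₁ : c₁ ∈ T₁ := hcT₁ (Finset.mem_singleton_self c₁)
    -- recurse in `C ∖ T₁` with the vertices `V ∖ c₁`
    have hV' : ∀ c ∈ V.erase c₁, ({c} : Finset (Fin h)) ∈ C.erase T₁ := by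
      intro c hc
      refine Finset.mem_erase.mpr ⟨fun heq => ?_, hV c (Finset.mem_of_mem_erase hc)⟩
      have : c₁ ∈ ({c} : Finset (Fin h)) := heq ▸ hc₁T₁
      exact Finset.ne_of_mem_erase hc (Finset.mem_singleton.mp this).symm
    have hm' : m ≤ (V.erase c₁).card := by rw [Finset.card_erase_of_mem hc₁]; omega
    obtain ⟨𝒯', h𝒯'C, hcard, hup, rep', hrep', hinj'⟩ := ih (C.erase T₁) (V.erase c₁) hV' hm'
    have hT₁𝒯' : T₁ ∉ 𝒯' := fun hT => Finset.notMem_erase T₁ C (h𝒯'C hT)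
    refine ⟨insert T₁ 𝒯', ?_, ?_, ?_, fun T => if T = T₁ then c₁ else rep' T, ?_, ?_⟩
    · exact Finset.insert_subset hT₁C (h𝒯'C.trans (Finset.erase_subset _ _))
    · rw [Finset.card_insert_of_notMem hT₁𝒯', hcard]
    · intro T hT T' hT'C hTT'
      by_cases hT'1 : T' = T₁
      · rw [hT'1]; exact Finset.mem_insert_self _ _
      · have hT'C' : T' ∈ C.erase T₁ := Finset.mem_erase.mpr ⟨hT'1, hT'C⟩
        rcases Finset.mem_insert.mp hT with rfl | hT𝒯'
        · exact absurd (hmax.eq_of_le hT'C hTT').symm hT'1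
        · exact Finset.mem_insert_of_mem (hup T hT𝒯' T' hT'C' hTT')
    · intro T hT
      dsimp only
      by_cases hTT : T = T₁
      · rw [if_pos hTT, hTT]; exact ⟨hc₁T₁, hc₁⟩
      · have hT𝒯' : T ∈ 𝒯' := (Finset.mem_insert.mp hT).resolve_left hTT
        rw [if_neg hTT]
        exact ⟨(hrep' T hT𝒯').1, Finset.mem_of_mem_erase (hrep' T hT𝒯').2⟩
    · intro T hT T' hT' heq
      simp only [Finset.coe_insert, Set.mem_insert_iff, Finset.mem_coe] at hT hT'
      dsimp only at heq
      by_cases hTT : T = T₁ <;> by_cases hTT' : T' = T₁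
      · rw [hTT, hTT']
      · have hT'𝒯' : T' ∈ 𝒯' := hT'.resolve_left hTT'
        rw [if_pos hTT, if_neg hTT'] at heq
        exact absurd heq.symm (Finset.ne_of_mem_erase (hrep' T' hT'𝒯').2)
      · have hT𝒯' : T ∈ 𝒯' := hT.resolve_left hTT
        rw [if_neg hTT, if_pos hTT'] at heq
        exact absurd heq (Finset.ne_of_mem_erase (hrep' T hT𝒯').2)
      · have hT𝒯' : T ∈ 𝒯' := hT.resolve_left hTT
        have hT'𝒯' : T' ∈ 𝒯' := hT'.resolve_left hTT'
        rw [if_neg hTT, if_neg hTT'] at heq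
        exact hinj' hT𝒯' hT'𝒯' heq

/-! ## 2. The deletion block from the stub-shaped hypothesis -/

/-- If the columns off the link rows form a lower sub-family of `Set.range w`, the stub-shaped deletion hypothesis gives the
nonsingularity of the deletion block. -/
theorem det_deletionBlock_ne_zero_of_hyp {s r : ℕ} {u w : Fin r → Finset (Fin h)} (hu : Function.Injective u)
    (hw : Function.Injective w) (a : Fin h)
    (hlow : IsLowerSet {T | ∃ j, a ∉ u j ∧ w j = T})
    (hdel : ∀ (r₀ : ℕ) (u₀ w₀ : Fin r₀ → Finset (Fin h)), Function.Injective u₀ → Function.Injective w₀ →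
      Set.range u₀ = {S | S ∈ Set.range u ∧ a ∉ S} → Set.range w₀ ⊆ Set.range w → IsLowerSet (Set.range w₀) →
      symbolicDet s h r₀ u₀ w₀ ≠ 0) :
    (Matrix.of fun i j : {i : Fin r // a ∉ u i} => coeff (pexpo (u i.1) (w j.1)) (symbolicWitness s h)).det ≠ 0 := by
  classical
  set e := Fintype.equivFin {i : Fin r // a ∉ u i} with he
  have hrange : Set.range (fun k => w (e.symm k).1) = {T | ∃ j, a ∉ u j ∧ w j = T} := by
    ext T
    constructor
    · rintro ⟨k, rfl⟩
      exact ⟨(e.symm k).1, (e.symm k).2, rfl⟩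
    · rintro ⟨j, hj, rfl⟩
      exact ⟨e ⟨j, hj⟩, by simp only [Equiv.symm_apply_apply]⟩
  have key := hdel (Fintype.card {i : Fin r // a ∉ u i}) (fun k => u (e.symm k).1) (fun k => w (e.symm k).1)
    (hu.comp (Subtype.val_injective.comp e.symm.injective)) (hw.comp (Subtype.val_injective.comp e.symm.injective))
    ?_ ?_ (hrange ▸ hlow)
  · have hsub : symbolicDet s h _ (fun k => u (e.symm k).1) (fun k => w (e.symm k).1) =
        ((Matrix.of fun i j : {i : Fin r // a ∉ u i} =>
          coeff (pexpo (u i.1) (w j.1)) (symbolicWitness s h)).submatrix e.symm e.symm).det := rfl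
    rwa [hsub, Matrix.det_submatrix_equiv_self] at key
  · ext S
    constructor
    · rintro ⟨k, rfl⟩
      exact ⟨⟨(e.symm k).1, rfl⟩, (e.symm k).2⟩
    · rintro ⟨⟨i, rfl⟩, hi⟩
      exact ⟨e ⟨i, hi⟩, by simp only [Equiv.symm_apply_apply]⟩
  · rw [hrange]
    rintro T ⟨j, -, rfl⟩
    exact ⟨j, rfl⟩

/-! ## 3. The thin vertex step -/

/-- **The thin vertex step** (see the module docstring): every profile `s ≥ 1`, every `h`. -/
theorem symbolicDet_ne_zero_of_thin (s h r : ℕ) (hs : 1 ≤ s) (u w : Fin r → Finset (Fin h))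
    (hu : Function.Injective u) (hw : Function.Injective w) (hlw : IsLowerSet (Set.range w)) (a : Fin h)
    (hthin : (Finset.univ.filter (fun i => a ∈ u i)).card ≤
      (Finset.univ.filter (fun c : Fin h => ∃ j, w j = {c})).card)
    (hdel : ∀ (r₀ : ℕ) (u₀ w₀ : Fin r₀ → Finset (Fin h)), Function.Injective u₀ → Function.Injective w₀ →
      Set.range u₀ = {S | S ∈ Set.range u ∧ a ∉ S} → Set.range w₀ ⊆ Set.range w → IsLowerSet (Set.range w₀) →
      symbolicDet s h r₀ u₀ w₀ ≠ 0) :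
    symbolicDet s h r u w ≠ 0 := by
  classical
  -- (1) the upper SDR
  set C : Finset (Finset (Fin h)) := Finset.univ.image w with hCdef
  set V : Finset (Fin h) := Finset.univ.filter (fun c : Fin h => ∃ j, w j = {c}) with hVdef
  have hV : ∀ c ∈ V, ({c} : Finset (Fin h)) ∈ C := by
    intro c hc
    obtain ⟨j, hj⟩ := (Finset.mem_filter.mp hc).2
    exact Finset.mem_image.mpr ⟨j, Finset.mem_univ _, hj⟩
  set m := (Finset.univ.filter (fun i => a ∈ u i)).card with hmdef
  obtain ⟨𝒯, h𝒯C, h𝒯card, hup, rep, hrep, hinj⟩ := exists_upper_sdr a m C V hV hthin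
  -- (2) the column permutation aligning the link rows with `𝒯`
  have hcard : Fintype.card {i : Fin r // a ∈ u i} = Fintype.card {j : Fin r // w j ∈ 𝒯} := by
    rw [Fintype.card_subtype, Fintype.card_subtype, ← hmdef, ← h𝒯card]
    have himg : 𝒯 = (Finset.univ.filter (fun j => w j ∈ 𝒯)).image w := by
      ext T
      constructor
      · intro hT
        obtain ⟨j, -, rfl⟩ := Finset.mem_image.mp (h𝒯C hT)
        exact Finset.mem_image.mpr ⟨j, Finset.mem_filter.mpr ⟨Finset.mem_univ _, hT⟩, rfl⟩
      · intro hT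
        obtain ⟨j, hj, rfl⟩ := Finset.mem_image.mp hT
        exact (Finset.mem_filter.mp hj).2
    conv_lhs => rw [himg]
    rw [Finset.card_image_of_injective _ hw]
  set β : {i : Fin r // a ∈ u i} ≃ {j : Fin r // w j ∈ 𝒯} := Fintype.equivOfCardEq hcard with hβ
  set π : Equiv.Perm (Fin r) := β.extendSubtype with hπ
  have hπmem : ∀ i, a ∈ u i → w (π i) ∈ 𝒯 := fun i hi => β.extendSubtype_mem i hi
  have hπnot : ∀ i, a ∉ u i → w (π i) ∉ 𝒯 := fun i hi => β.extendSubtype_not_mem i hi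
  apply symbolicDet_ne_zero_of_perm s h r u w π
  -- (3) the design on the permuted layout `(u, w ∘ π)`
  set w' : Fin r → Finset (Fin h) := w ∘ π with hw'
  have hw'i : Function.Injective w' := hw.comp π.injective
  have hw'val : ∀ i, w' i = w (π i) := fun i => rfl
  -- the row served by a design vertex (choice), its link face and its column
  have hlink_unique : ∀ i i', a ∈ u i → a ∈ u i' → rep (w' i) = rep (w' i') → i = i' := by
    intro i i' hi hi' heq
    have h1 : w' i = w' i' := hinj (hπmem i hi) (hπmem i' hi') heq
    exact hw'i h1
  let Sx : Fin h → Finset (Fin h) := fun c =>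
    if hc : ∃ i, a ∈ u i ∧ rep (w' i) = c then (u (Classical.choose hc)).erase a else ∅
  let τ : Fin h → Finset (Fin h) := fun c =>
    if hc : ∃ i, a ∈ u i ∧ rep (w' i) = c then w' (Classical.choose hc) else ∅
  set D : Finset (Fin h) := (Finset.univ.filter (fun i => a ∈ u i)).image (fun i => rep (w' i)) with hDdef
  have hSx : ∀ i, a ∈ u i → Sx (rep (w' i)) = (u i).erase a := by
    intro i hi
    have hc : ∃ i', a ∈ u i' ∧ rep (w' i') = rep (w' i) := ⟨i, hi, rfl⟩
    simp only [Sx, dif_pos hc]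
    rw [hlink_unique _ _ (Classical.choose_spec hc).1 hi (Classical.choose_spec hc).2]
  have hτ : ∀ i, a ∈ u i → τ (rep (w' i)) = w' i := by
    intro i hi
    have hc : ∃ i', a ∈ u i' ∧ rep (w' i') = rep (w' i) := ⟨i, hi, rfl⟩
    simp only [τ, dif_pos hc]
    rw [hlink_unique _ _ (Classical.choose_spec hc).1 hi (Classical.choose_spec hc).2]
  have hDmem : ∀ c ∈ D, ∃ i, a ∈ u i ∧ rep (w' i) = c := by
    intro c hc
    obtain ⟨i, hi, rfl⟩ := Finset.mem_image.mp hc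
    exact ⟨i, (Finset.mem_filter.mp hi).2, rfl⟩
  refine symbolicDet_ne_zero_of_thinDesign s h r hs u w' hw'i a D Sx τ ?_ ?_ ?_ ?_ ?_
  · -- `a ∉ Sx c`
    intro c hc
    obtain ⟨i, hi, rfl⟩ := hDmem c hc
    rw [hSx i hi]; exact Finset.notMem_erase a _
  · -- `c ∈ τ c`
    intro c hc
    obtain ⟨i, hi, rfl⟩ := hDmem c hc
    rw [hτ i hi]; exact (hrep (w' i) (hπmem i hi)).1
  · -- link faces are distinct
    intro c hc c' hc' heq
    obtain ⟨i, hi, rfl⟩ := hDmem c hc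
    obtain ⟨i', hi', rfl⟩ := hDmem c' hc'
    rw [hSx i hi, hSx i' hi'] at heq
    have : u i = u i' := by rw [← Finset.insert_erase hi, ← Finset.insert_erase hi', heq]
    rw [hu this]
  · -- every link row is served
    intro i hi
    exact ⟨rep (w' i), Finset.mem_image.mpr ⟨i, Finset.mem_filter.mpr ⟨Finset.mem_univ _, hi⟩, rfl⟩, hSx i hi, hτ i hi⟩
  · -- the deletion block of `(u, w')`: columns `C ∖ 𝒯`, a lower family
    refine det_deletionBlock_ne_zero_of_hyp hu hw'i a ?_ ?_
    · intro T T' hT'T ⟨j, hj, hjT⟩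
      -- `T' ⊆ T = w' j ∉ 𝒯`; `T' ∈ range w` by lowerness; `T' ∉ 𝒯` by upperness
      have hT'range : T' ∈ Set.range w := hlw hT'T ⟨π j, hjT⟩
      obtain ⟨j', hj'⟩ := hT'range
      have hT'not : T' ∉ 𝒯 := by
        intro hT'
        have hTC : T ∈ C := Finset.mem_image.mpr ⟨π j, Finset.mem_univ _, hjT⟩
        exact hπnot j hj (show w (π j) ∈ 𝒯 by rw [← hw'val, hjT]; exact hup T' hT' T hTC hT'T)
      refine ⟨π.symm j', fun hmem => hT'not ?_, by rw [hw'val, Equiv.apply_symm_apply, hj']⟩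
      have := hπmem (π.symm j') hmem
      rwa [Equiv.apply_symm_apply, hj'] at this
    · intro r₀ u₀ w₀ hu₀ hw₀ hru₀ hrw₀ hlw₀
      refine hdel r₀ u₀ w₀ hu₀ hw₀ hru₀ (hrw₀.trans ?_) hlw₀
      rintro T ⟨j, rfl⟩
      exact ⟨π j, rfl⟩

/-- **The thin vertex step at profile 1, in the exact shape of the registered stub `Stmt.stub_vertexStep` plus the thinness
inequality** `#{i : a ∈ u i} ≤ #{c : {c} is a column}`. -/
theorem stub_vertexStep_thin :
    ∀ (h r : ℕ) (u w : Fin r → Finset (Fin h)), Function.Injective u → Function.Injective w →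
      IsLowerSet (Set.range u) → IsLowerSet (Set.range w) →
      ∀ (a : Fin h), (∃ i, a ∈ u i) →
        (Finset.univ.filter (fun i => a ∈ u i)).card ≤ (Finset.univ.filter (fun c : Fin h => ∃ j, w j = {c})).card →
        (∀ (r₀ : ℕ) (u₀ w₀ : Fin r₀ → Finset (Fin h)), Function.Injective u₀ → Function.Injective w₀ →
            Set.range u₀ = {S | S ∈ Set.range u ∧ a ∉ S} → Set.range w₀ ⊆ Set.range w → IsLowerSet (Set.range w₀) →
            symbolicDet 1 h r₀ u₀ w₀ ≠ 0) →
        symbolicDet 1 h r u w ≠ 0 :=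
  fun h r u w hu hw _ hlw a _ hthin hdel => symbolicDet_ne_zero_of_thin 1 h r le_rfl u w hu hw hlw a hthin hdel

end ThinStep

end

end Summit.ValiantsHypothesis.ValiantsHypothesis.Theorems.BarrierLever.AnchoredPeeling
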